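import Summits.CriticalPhenomena.SAWScalingLimit.Theses.SAWLeftRightFKG

/-! Scratch (cstrat s2): the four def-free children of the route-level split of `FKGToTraversalBound`,
elaborated in EXACTLY the route file's context (its imports + its namespace + its `open`s). -/

namespace Summit.CriticalPhenomena.SAWScalingLimit.Theses.SAWLeftRightFKG

open scoped BigOperators Topology Manifold Classical MeasureTheory ProbabilityTheory Matrix InnerProductSpace ComplexConjugate ContinuousMap
open Filter Set Function TopologicalSpace MeasureTheory

def CriticalBubbleBound : Prop :=
  ∃ C : ENNReal, C ≠ ⊤ ∧ ∀ (Ω : Set ℂ) (δ : ℝ) (u v : Literature.Probability.LatticeModels.Site 2), Bornology.IsBounded Ω → 0 < δ → (Literature.Probability.LatticeModels.zdGraph 2).Adj u v → Literature.Probability.RandomPlanarGeometry.SAW.weight Ω δ u v Set.univ ≤ C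

def BubbleFKGEngine : Prop :=
  LeftRightFKG → (∃ C : ENNReal, C ≠ ⊤ ∧ ∀ (Ω : Set ℂ) (δ : ℝ) (u v : Literature.Probability.LatticeModels.Site 2), Bornology.IsBounded Ω → 0 < δ → (Literature.Probability.LatticeModels.zdGraph 2).Adj u v → Literature.Probability.RandomPlanarGeometry.SAW.weight Ω δ u v Set.univ ≤ C) → ∀ ε : ℝ, 0 < ε → ∀ n₀ : ℕ, ∃ n : ℕ, ∀ (δ : ℝ) (c u v u' v' : Literature.Probability.LatticeModels.Site 2) (C : (Literature.Probability.LatticeModels.zdGraph 2).Walk c c), let Ω : Set ℂ := {z | Literature.Topology.PlaneTopology.wind (fun t : ℝ => Set.IccExtend zero_le_one (C.toCurve (Literature.Probability.LatticeModels.meshPoint δ)) t - z) ≠ 0}; 0 < δ → u' ∈ C.support → v' ∈ C.support → (Literature.Probability.LatticeModels.zdGraph 2).Adj u u' → (Literature.Probability.LatticeModels.zdGraph 2).Adj v v' → ∀ (x : ℂ) (ρ R : ℝ), δ ≤ ρ → 2 * ρ ≤ R → (∃ γ₀ : Literature.Probability.RandomPlanarGeometry.SAW.DomainSAW Ω δ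 u v, ¬ (⟨γ₀.walk.toCurve (Literature.Probability.LatticeModels.meshPoint δ)⟩ : Literature.Probability.RandomPlanarGeometry.Curve ℂ).HasTraversals (n₀ + 1) x ((3 * ρ + R) / 4) ((ρ + 3 * R) / 4)) → Literature.Probability.RandomPlanarGeometry.SAW.law Ω δ u v {γ | (⟨γ.walk.toCurve (Literature.Probability.LatticeModels.meshPoint δ)⟩ : Literature.Probability.RandomPlanarGeometry.Curve ℂ).HasTraversals n x ρ R} ≤ ENNReal.ofReal ε

def GermTightness : Prop :=
  ∀ (D : Literature.Probability.RandomPlanarGeometry.DobrushinDomain) (a b : ℝ → Literature.Probability.LatticeModels.Site 2), Literature.Probability.RandomPlanarGeometry.SAW.IsEndpointApprox D a b → (∀ r : ℝ, 0 < r → ∀ ε : ℝ, 0 < ε → ∃ n : ℕ, ∀ᶠ δ in nhdsWithin (0 : ℝ) (Set.Ioi 0), Literature.Probability.RandomPlanarGeometry.SAW.law D.carrier δ (a δ) (b δ) {γ | (⟨γ.walk.toCurve (Literature.Probability.LatticeModels.meshPoint δ)⟩ : Literature.Probability.RandomPlanarGeometry.Curve ℂ).HasTraversals n (Literature.Probability.LatticeModels.meshPoint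 δ (a δ)) (2 * Metric.infDist (Literature.Probability.LatticeModels.meshPoint δ (a δ)) D.carrierᶜ + 4 * δ) r} ≤ ENNReal.ofReal ε) ∧ (∀ r : ℝ, 0 < r → ∀ ε : ℝ, 0 < ε → ∃ n : ℕ, ∀ᶠ δ in nhdsWithin (0 : ℝ) (Set.Ioi 0), Literature.Probability.RandomPlanarGeometry.SAW.law D.carrier δ (a δ) (b δ) {γ | (⟨γ.walk.toCurve (Literature.Probability.LatticeModels.meshPoint δ)⟩ : Literature.Probability.RandomPlanarGeometry.Curve ℂ).HasTraversals n (Literature.Probability.LatticeModels.meshPoint δ (b δ)) (2 * Metric.infDist (Literature.Probability.LatticeModels.meshPoint δ (b δ)) D.carrierᶜ + 4 * δ) r} ≤ ENNReal.ofReal ε)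

def WildNecklaceResidue : Prop :=
  (∀ ε : ℝ, 0 < ε → ∀ n₀ : ℕ, ∃ n : ℕ, ∀ (δ : ℝ) (c u v u' v' : Literature.Probability.LatticeModels.Site 2) (C : (Literature.Probability.LatticeModels.zdGraph 2).Walk c c), let Ω : Set ℂ := {z | Literature.Topology.PlaneTopology.wind (fun t : ℝ => Set.IccExtend zero_le_one (C.toCurve (Literature.Probability.LatticeModels.meshPoint δ)) t - z) ≠ 0}; 0 < δ → u' ∈ C.support → v' ∈ C.support → (Literature.Probability.LatticeModels.zdGraph 2).Adj u u' → (Literature.Probability.LatticeModels.zdGraph 2).Adj v v' → ∀ (x : ℂ) (ρ R : ℝ), δ ≤ ρ → 2 * ρ ≤ R → (∃ γ₀ : Literature.Probability.RandomPlanarGeometry.SAW.DomainSAW Ω δ u v, ¬ (⟨γ₀.walk.toCurve (Literature.Probability.LatticeModels.meshPoint δ)⟩ : Literature.Probability.RandomPlanarGeometry.Curve ℂ).HasTraversals (n₀ + 1) x ((3 * ρ + R) / 4) ((ρ + 3 * R) / 4)) → Literature.Probability.RandomPlanarGeometry.SAW.law Ω δ u v {γ | (⟨γ.walk.toCurve (Literature.Probability.LatticeModels.meshPoint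 δ)⟩ : Literature.Probability.RandomPlanarGeometry.Curve ℂ).HasTraversals n x ρ R} ≤ ENNReal.ofReal ε) → ∀ (D : Literature.Probability.RandomPlanarGeometry.DobrushinDomain) (a b : ℝ → Literature.Probability.LatticeModels.Site 2), Literature.Probability.RandomPlanarGeometry.SAW.IsEndpointApprox D a b → ¬ (∃ N₀ : ℕ, ∀ᶠ δ in nhdsWithin (0 : ℝ) (Set.Ioi 0), ∃ (c : Literature.Probability.LatticeModels.Site 2) (C : (Literature.Probability.LatticeModels.zdGraph 2).Walk c c) (S : Finset (Literature.Probability.LatticeModels.Site 2)), S.card ≤ N₀ ∧ ∀ x y : Literature.Probability.LatticeModels.Site 2, (Literature.Probability.LatticeModels.discreteDomainGraph {z | Literature.Topology.PlaneTopology.wind (fun t : ℝ => Set.IccExtend zero_le_one (C.toCurve (Literature.Probability.LatticeModels.meshPoint δ)) t - z) ≠ 0} δ).Adj x y ↔ ((Literature.Probability.LatticeModels.discreteDomainGraph D.carrier δ).Adj x y ∧ x ∉ S ∧ y ∉ S)) → (∀ r : ℝ, 0 < r → ∀ ε : ℝ, 0 < ε → ∃ n : ℕ, ∀ᶠ δ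 in nhdsWithin (0 : ℝ) (Set.Ioi 0), Literature.Probability.RandomPlanarGeometry.SAW.law D.carrier δ (a δ) (b δ) {γ | (⟨γ.walk.toCurve (Literature.Probability.LatticeModels.meshPoint δ)⟩ : Literature.Probability.RandomPlanarGeometry.Curve ℂ).HasTraversals n (Literature.Probability.LatticeModels.meshPoint δ (a δ)) (2 * Metric.infDist (Literature.Probability.LatticeModels.meshPoint δ (a δ)) D.carrierᶜ + 4 * δ) r} ≤ ENNReal.ofReal ε) → (∀ r : ℝ, 0 < r → ∀ ε : ℝ, 0 < ε → ∃ n : ℕ, ∀ᶠ δ in nhdsWithin (0 : ℝ) (Set.Ioi 0), Literature.Probability.RandomPlanarGeometry.SAW.law D.carrier δ (a δ) (b δ) {γ | (⟨γ.walk.toCurve (Literature.Probability.LatticeModels.meshPoint δ)⟩ : Literature.Probability.RandomPlanarGeometry.Curve ℂ).HasTraversals n (Literature.Probability.LatticeModels.meshPoint δ (b δ)) (2 * Metric.infDist (Literature.Probability.LatticeModels.meshPoint δ (b δ)) D.carrierᶜ + 4 * δ) r} ≤ ENNReal.ofReal ε) → ∀ (x : ℂ) (ρ R : ℝ), 0 <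 ρ → 2 * ρ ≤ R → R ≤ 1 → ∀ ε : ℝ, 0 < ε → ∃ n : ℕ, ∀ᶠ δ in nhdsWithin (0 : ℝ) (Set.Ioi 0), Literature.Probability.RandomPlanarGeometry.SAW.law D.carrier δ (a δ) (b δ) {γ | (⟨γ.walk.toCurve (Literature.Probability.LatticeModels.meshPoint δ)⟩ : Literature.Probability.RandomPlanarGeometry.Curve ℂ).HasTraversals n x ρ R} ≤ ENNReal.ofReal ε

end Summit.CriticalPhenomena.SAWScalingLimit.Theses.SAWLeftRightFKG
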